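import Mathlib
import Summits.ValiantsHypothesis.ValiantsHypothesis.Theorems.BarrierLeverPartitionMinorsHitByVPHiddenStatesAffineSplit

/-!
# Route BarrierLever — item `PartitionMinorsHitByVP` (stmt-ValiantsHypothesis-19717), line `hidden-states`:
# PASCAL CUTS ARE AFFINELY CLOSED — the ball game's moves satisfy the combinatorial split hypothesis for free

Helper file (`--supports stmt-ValiantsHypothesis-19717`; cell valiant-natproofs, rung V4, 𝒟-side door (c), registered line
`Cruxes/PartitionMinorsHitByVP/Lines/hidden_states.lean` v4, stubs `stub_universalJoinWide` / `stub_fit`; prover seat val-np-p6 gen 8).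
No definitions. Closes NO item.

THE POINT (memo val-np-p6 g8 §5★ «THE BALL GAME», PROBLEM-BallGame-valnp6-g8.md). In the BALL GAME every piece, at every node, is treated in
one of four ways: all its current columns go to the deletion side, none do, exactly those whose member set AVOIDS a chosen state `q` do
(`{J : q ∉ J}`), or exactly those whose member set CONTAINS `q` do (`{J : q ∈ J}`) — the two halves of a Pascal split, in either orientation.
This file proves that such «Pascal classes» automatically satisfy the affine-closure hypothesis of the constant-free split node
`symGood_of_affSplit` (p591757): no column outside the class has its affine row vector `(1, 1_J)` in the span of the affine row vectors of
the class (`affRow_notMem_span_of_pascal`), by two one-line invariants of the span (coordinate `q` vanishes on it, resp. coordinate `q`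
equals coordinate `none` on it). Consequence `symGood_of_pascalSplit`: a split node whose deletion class is piece-wise Pascal needs NO
affine-geometric side condition at all — so every winning play of the ball game is, node by node, an `AFit`/`Fit`-style kernel proof
(leaves by `symGood_of_affFree`, p589275). Together with the census (the fully peeled design wins the ball game against every tested down-set,
h ≤ 9) this is the shortest known route from a finite combinatorial statement (CONJECTURE BALL-LADDER) to the node.

WHAT THIS IS NOT: no family is certified here; BALL-LADDER is a conjecture; item 19717 OPEN; nothing on crux 14610 or VP ≠ VNP.
-/

set_option linter.dupNamespace false

namespace Summit.ValiantsHypothesis.ValiantsHypothesis.Theorems.BarrierLever.HiddenStates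

open Finset Matrix MvPolynomial

noncomputable section

namespace SymbJoin

variable {h m K r r₀ r₁ : ℕ}

/-- **Avoid-`q` classes are affinely closed.** If every member set in the class avoids `q` and `J` contains `q`, then the affine row
vector of `J` is not in the span of the affine row vectors of the class (its `q`-coordinate is `1`, theirs are `0`). -/
theorem affRow_notMem_span_of_avoid (q : Fin K) (S : Set (Finset (Fin K))) (hS : ∀ J' ∈ S, q ∉ J') (J : Finset (Fin K)) (hJ : q ∈ J) :
    (fun o : Option (Fin K) => Option.elim o (1 : ℂ) fun q' => if q' ∈ J then 1 else 0) ∉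
      Submodule.span ℂ ((fun J' => fun o : Option (Fin K) => Option.elim o (1 : ℂ) fun q' => if q' ∈ J' then 1 else 0) '' S) := by
  classical
  intro hmem
  -- the linear functional «evaluate at `some q`» vanishes on the span
  have hzero : ∀ v ∈ Submodule.span ℂ ((fun J' => fun o : Option (Fin K) => Option.elim o (1 : ℂ) fun q' => if q' ∈ J' then 1 else 0) '' S),
      v (some q) = 0 := by
    intro v hv
    induction hv using Submodule.span_induction with
    | mem x hx =>
      obtain ⟨J', hJ', rfl⟩ := hx
      simp [hS J' hJ']
    | zero => rfl
    | add x y _ _ hx hy => simp [hx, hy]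
    | smul a x _ hx => simp [hx]
  have := hzero _ hmem
  simp [hJ] at this

/-- **Contain-`q` classes are affinely closed.** If every member set in the class contains `q` and `J` avoids `q`, then the affine row
vector of `J` is not in the span of the affine row vectors of the class (on the span the `q`-coordinate equals the `none`-coordinate). -/
theorem affRow_notMem_span_of_contain (q : Fin K) (S : Set (Finset (Fin K))) (hS : ∀ J' ∈ S, q ∈ J') (J : Finset (Fin K)) (hJ : q ∉ J) :
    (fun o : Option (Fin K) => Option.elim o (1 : ℂ) fun q' => if q' ∈ J then 1 else 0) ∉
      Submodule.span ℂ ((fun J' => fun o : Option (Fin K) => Option.elim o (1 : ℂ) fun q' => if q' ∈ J' then 1 else 0) '' S) := by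
  classical
  intro hmem
  have hdiag : ∀ v ∈ Submodule.span ℂ ((fun J' => fun o : Option (Fin K) => Option.elim o (1 : ℂ) fun q' => if q' ∈ J' then 1 else 0) '' S),
      v (some q) = v none := by
    intro v hv
    induction hv using Submodule.span_induction with
    | mem x hx =>
      obtain ⟨J', hJ', rfl⟩ := hx
      simp [hS J' hJ']
    | zero => rfl
    | add x y _ _ hx hy => simp [hx, hy]
    | smul a x _ hx => simp [hx]
  have := hdiag _ hmem
  simp [hJ] at this

/-- **THE PASCAL SPLIT NODE.** As `symGood_of_affSplit`, but the deletion class is PIECE-WISE PASCAL: for every piece `p` there is a state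
`q p` and a mode — `0`: all columns of `p` are in the deletion class, `1`: none is, `2`: exactly those avoiding `q p`, `3`: exactly those
containing `q p`. Then no affine-geometric hypothesis is needed. -/
theorem symGood_of_pascalSplit (u : Fin r → Finset (Fin h)) (e : Fin r → Fin m × Finset (Fin K)) (x : Fin h) (hr : r₀ + r₁ = r)
    (f₀ : Fin r₀ → Fin r) (f₁ : Fin r₁ → Fin r) (g₀ : Fin r₀ → Fin r) (g₁ : Fin r₁ → Fin r)
    (hf : Function.Injective (Sum.elim f₀ f₁)) (hg : Function.Injective (Sum.elim g₀ g₁))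
    (hrow0 : ∀ j, x ∉ u (f₀ j)) (hrow1 : ∀ j, x ∈ u (f₁ j))
    (mode : Fin m → Fin 4) (q : Fin m → Fin K)
    (hmode : ∀ k, k ∈ Finset.univ.image g₀ ↔
      (mode (e k).1 = 0 ∨ (mode (e k).1 = 2 ∧ q (e k).1 ∉ (e k).2) ∨ (mode (e k).1 = 3 ∧ q (e k).1 ∈ (e k).2)))
    (h0 : symDet (fun j : Fin r₀ => u (f₀ j)) (fun j => e (g₀ j)) ≠ 0)
    (h1 : symDet (fun j : Fin r₁ => (u (f₁ j)).erase x) (fun j => e (g₁ j)) ≠ 0) :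
    symDet u e ≠ 0 := by
  classical
  refine symGood_of_affSplit u e x hr f₀ f₁ g₀ g₁ hf hg hrow0 hrow1 ?_ h0 h1
  intro k hk
  -- the class of k's piece, as a set of member sets
  set p := (e k).1 with hp
  have hk' := fun hh => hk ((hmode k).mpr hh)
  -- rewrite the span over columns as a span over member sets of the class
  have hsub : ((fun k' => fun o : Option (Fin K) => Option.elim o (1 : ℂ) fun q' => if q' ∈ (e k').2 then 1 else 0) ''
        {k' | k' ∈ Finset.univ.image g₀ ∧ (e k').1 = (e k).1})
      ⊆ ((fun J' => fun o : Option (Fin K) => Option.elim o (1 : ℂ) fun q' => if q' ∈ J' then 1 else 0) ''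
        {J' | ∃ k', k' ∈ Finset.univ.image g₀ ∧ (e k').1 = (e k).1 ∧ (e k').2 = J'}) := by
    rintro v ⟨k', ⟨hk'0, hk'p⟩, rfl⟩
    exact ⟨(e k').2, ⟨k', hk'0, hk'p, rfl⟩, rfl⟩
  intro hmem
  have hmem' := Submodule.span_mono hsub hmem
  -- case analysis on the mode of k's piece
  have hm : mode p = 0 ∨ mode p = 1 ∨ mode p = 2 ∨ mode p = 3 := by
    have := (mode p).2; omega
  have key : ∀ {a b : Fin 4}, mode p = a → mode p = b → a ≠ b → False := fun ha hb hne => hne (ha.symm.trans hb)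
  rcases hm with h0m | h1m | h2m | h3m
  · exact hk' (Or.inl h0m)
  · -- no column of the piece is in the class: the generating set is empty
    have hempty : {J' | ∃ k', k' ∈ Finset.univ.image g₀ ∧ (e k').1 = (e k).1 ∧ (e k').2 = J'} = (∅ : Set (Finset (Fin K))) := by
      ext J'
      simp only [Set.mem_setOf_eq, Set.mem_empty_iff_false, iff_false, not_exists, not_and]
      intro k' hk'0 hk'p hJ'
      have := (hmode k').mp hk'0
      rw [hk'p] at this
      rcases this with h' | ⟨h', _⟩ | ⟨h', _⟩
      · exact key h' h1m (by decide)
      · exact key h' h1m (by decide)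
      · exact key h' h1m (by decide)
    rw [hempty, Set.image_empty, Submodule.span_empty] at hmem'
    have := congrFun ((Submodule.mem_bot ℂ).mp hmem') none
    simp at this
  · -- avoid-q class: k is outside, so q ∈ J_k
    have hqk : q p ∈ (e k).2 := by
      by_contra hq
      exact hk' (Or.inr (Or.inl ⟨h2m, hq⟩))
    refine affRow_notMem_span_of_avoid (q p) _ ?_ (e k).2 hqk hmem'
    rintro J' ⟨k', hk'0, hk'p, rfl⟩
    have := (hmode k').mp hk'0
    rw [hk'p] at this
    rcases this with h' | ⟨_, h'⟩ | ⟨h', _⟩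
    · exact (key h' h2m (by decide)).elim
    · exact h'
    · exact (key h' h2m (by decide)).elim
  · -- contain-q class: k is outside, so q ∉ J_k
    have hqk : q p ∉ (e k).2 := by
      intro hq
      exact hk' (Or.inr (Or.inr ⟨h3m, hq⟩))
    refine affRow_notMem_span_of_contain (q p) _ ?_ (e k).2 hqk hmem'
    rintro J' ⟨k', hk'0, hk'p, rfl⟩
    have := (hmode k').mp hk'0
    rw [hk'p] at this
    rcases this with h' | ⟨h', _⟩ | ⟨_, h'⟩
    · exact (key h' h3m (by decide)).elim
    · exact (key h' h3m (by decide)).elim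
    · exact h'

end SymbJoin

end

end Summit.ValiantsHypothesis.ValiantsHypothesis.Theorems.BarrierLever.HiddenStates
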